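import Summits.QuantumFields.YangMills.Theorems.BalabanUVNodesN07EmapOfRecordRealSlice
import Summits.QuantumFields.YangMills.Theorems.BalabanUVNodesN07FrakGOfRecordReality
import HarnessLib

/-!
# NODE N07 — THE TRANSPOSED CURRENTS AND PRINT'S `Δ_π`-LETTER ON THE REAL SLICE: `Mᵗ K` is Hermitian for real `M` and Hermitian `K`; def-Y's `Δπ := DeltaPiCurOfRecord`
# is real for real `G′`; hence (88)–(89)'s `W₂(A′)`, `W₃(A′)` are HERMITIAN at Hermitian `A′` with `‖A′‖ < a_C` — the `Δ_π`∕transpose part of the «`W` maps real to real»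
# ROW of def-Y's ✓`Node00.BgSchemeChartLie.sol_mem_of_rows` ([15] (27) p. 282, (85)–(89) p. 291; [B9] (3.119) p. 419, p. 392)

Cell `pub-ymgap`, width seat `pub-ymgap-dag-n07-w3` (g26), CLAIM-11.  `--kind proof --supports stmt-QuantumFields-27238 --as helper`; count-neutral.
[15] = [Balaban1985Variational]; [B9] = [Balaban1985BackgroundPropagators].

CONTENTS (`σ` = bondwise conjugation; «real» = commutes with `σ`; «Hermitian» = `σ`-fixed).
* §1 `pair27_conj_left` (`⟨Kᴴ, δ⟩₍₂₇₎ = conj ⟨K, δᴴ⟩₍₂₇₎`), `eq_of_forall_pair27_eq` (the pairing (27) is perfect in its first slot).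
* §2 `conjJet_map_of_hermPreserving` — a ℂ-LINEAR map of the space (115) of record preserving Hermitian jets commutes with `σ` (split `Y = Y₁ + iY₂`).
* §3 ★★`conjNeg3_transCur` — `σ(Mᵗ K) = Mᵗ (σK)` for real `M` (lit `B11Eq90Transpose.transCur`, characterised by ✓`pair27_transCur`); `transCur_herm`.
* §4 `hessOpOfRecordPiT_starW` (`πᵗΔπ` real for real `G′`), ★★`conjNeg3_DeltaPiCurOfRecord` (def-Y's `Δπ` maps `σY` to `σ(ΔπY)`), `DeltaPiCurOfRecord_herm`.
* §5 ★★`W2OfRecord_herm`, ★★`W3OfRecord_herm` — at def-Y's letters `H♭`, `C^{𝔰𝔩}`, `Δπ`, for Hermitian `A′`, `‖A′‖ < a_C` (guard; Sect. C regime, `Prop4Hyp`, `hCreal` displayed as in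
  ✓`…N07EmapOfRecordRealSlice`; real `G′`), `(W₂ A′)ᴴ = W₂ A′` and `(W₃ A′)ᴴ = W₃ A′`.

HONEST LABELS.  Linear `*`-algebra plus the fixed-point facts of ✓`…N07EmapOfRecordRealSlice`; `W₁` (needs `D(H♭C⁽²⁾)`) and the `V₀`-group `curV0full` of (90)–(96) are NOT here;
no estimate; the regime letters are displayed.  Count-neutral; N07 NOT discharged; P0 ⟨26900⟩ OPEN; R4 is the conditional finite-𝕋⁴ rung only.  Nothing here is a claim
about the Yang–Mills mass gap (`Summit.QuantumFields`): finite torus, fixed `ε`; nothing continuum ∕ OS ∕ Clay.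
-/

set_option autoImplicit false

noncomputable section

open scoped Matrix Matrix.Norms.L2Operator InnerProductSpace ComplexConjugate BigOperators Topology

namespace Summit.QuantumFields.YangMills.Theorems.N07W23OfRecordRealSlice

open Filter Metric
open Literature.MathematicalPhysics.QuantumFieldTheory.Balaban1983to89
open Literature.MathematicalPhysics.QuantumFieldTheory.Balaban1983to89.T4Continuum (T4Family)
open T4Continuum BlockAveraging
open B9SectCLatticeCarrier (Bond)
open B9Eq311L2Pairing (WL2)
open B9Eq311TracePairing (starW equiv_starW apply_equiv_starW starW_starW realConj btrans)
open B11Eq111FrakG (nabla115)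
open B11Eq103H1Complex (SiteL2K BondL2K funEquiv readFun readFun_apply)
open B11Eq115Space (NegSize NegSup levWeight JetSup)
open B11Eq90V0primeCurrent (flat115 flat115_apply)
open B11Eq90Transpose (pair27 pair27_eq_sum transCur pair27_transCur single115)
open B9Eq3119DeltaPiCarrier (currentCLM equiv_currentCLM deltaPi)
open B9Eq3119DeltaPiReality (real_comp real_adjoint realConj_eq_self_iff)
open B11Eq80Current (Emap W2 W3)
open B11Eq174Chart (Regime)
open B11Prop6Scheme (Prop4Hyp)
open Node00
open Summit.QuantumFields.YangMills.Theorems.N07HessOpOfRecordSymmetric (tauRec_star tauRec_mul_comm)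
open Summit.QuantumFields.YangMills.Theorems.N07RecordLettersReality (hessOpOfRecord_starW)
open Summit.QuantumFields.YangMills.Theorems.N07H1OfRecordReality (funEquiv_symm_star)
open Summit.QuantumFields.YangMills.Theorems.N07Delta2OfRecordReal (flat115_conj)
open Summit.QuantumFields.YangMills.Theorems.N07QuadPartReality (conjJet_add conjJet_sub conjJet_smul conjJet_conjJet)
open Summit.QuantumFields.YangMills.Theorems.N07FrakGOfRecordReality (funEquiv_starW piOfRecord_starW)
open Summit.QuantumFields.YangMills.Theorems.N07EmapOfRecordRealSlice (conjJet_EmapOfRecord_eq conjJet_fderiv_EmapOfRecord_eq)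

variable (F : T4Family) (N : ℕ) (K : ℕ) (k : ℕ) (Ω : ℕ → Set (Site (F.P K) 0)) (U₀ : GaugeField (F.P K) 0 (SU N))
  [Fact (0 < (F.L : ℝ))] [Fact (0 < (F.P K).eta k)]

/-! ## §1  The pairing (27) against conjugate currents; perfectness -/

omit [Fact (0 < (F.L : ℝ))] [Fact (0 < (F.P K).eta k)] in
/-- **`⟨Kᴴ, δ⟩₍₂₇₎ = conj ⟨K, δᴴ⟩₍₂₇₎`** (`tr(Kᴴδ) = conj tr(δᴴK) = conj tr(Kδᴴ)`). [cite: Balaban1985Variational, (27) p.282; Balaban1985BackgroundPropagators, (3.11) p.392] -/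
theorem pair27_conj_left (Kc : NegSizeLit F N K k Ω 3) (δ : Bond (F.P K).d (fun _ => (F.P K).sitesPerDir 0) → Matrix (Fin N) (Fin N) ℂ) :
    pair27 (tauRecCLM N) ((NegSup.equiv _ _).symm (star (NegSup.equiv (levWeight (F.L : ℝ) ((F.P K).eta k) (bondLevLit F Ω k) 3) (Matrix (Fin N) (Fin N) ℂ) Kc)) :
        NegSizeLit F N K k Ω 3) δ =
      conj (pair27 (tauRecCLM N) Kc (star δ)) := by
  rw [pair27_eq_sum, pair27_eq_sum, map_mul, map_pow, Complex.conj_ofReal, map_sum]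
  congr 1
  refine Finset.sum_congr rfl fun b _ => ?_
  rw [Equiv.apply_symm_apply, Pi.star_apply, tauRecCLM_apply, tauRecCLM_apply, Pi.star_apply, starRingEnd_apply, ← Matrix.trace_conjTranspose,
    Matrix.conjTranspose_mul, ← Matrix.star_eq_conjTranspose, ← Matrix.star_eq_conjTranspose, star_star, Matrix.trace_mul_comm]

omit [Fact (0 < (F.L : ℝ))] in
/-- **THE PAIRING (27) IS PERFECT IN ITS FIRST SLOT**: a current is determined by its pairings against all bond functions (test with `δ(b) := K(b)ᴴ`:
`Σ_b tr(K(b)K(b)ᴴ) = 0` forces `K = 0`). [cite: Balaban1985Variational, (27) p.282] -/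
theorem eq_of_forall_pair27_eq {K₁ K₂ : NegSizeLit F N K k Ω 3}
    (h : ∀ δ : Bond (F.P K).d (fun _ => (F.P K).sitesPerDir 0) → Matrix (Fin N) (Fin N) ℂ, pair27 (tauRecCLM N) K₁ δ = pair27 (tauRecCLM N) K₂ δ) : K₁ = K₂ := by
  have hη : ((((F.P K).eta k : ℝ) : ℂ)) ^ (F.P K).d ≠ 0 := pow_ne_zero _ (by exact_mod_cast (Fact.out : 0 < (F.P K).eta k).ne')
  -- the difference pairs to zero against everything
  set Dc : Bond (F.P K).d (fun _ => (F.P K).sitesPerDir 0) → Matrix (Fin N) (Fin N) ℂ :=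
    NegSup.equiv (levWeight (F.L : ℝ) ((F.P K).eta k) (bondLevLit F Ω k) 3) (Matrix (Fin N) (Fin N) ℂ) K₁ -
      NegSup.equiv (levWeight (F.L : ℝ) ((F.P K).eta k) (bondLevLit F Ω k) 3) (Matrix (Fin N) (Fin N) ℂ) K₂ with hDc
  have hsum : ∑ b, Matrix.trace (Dc b * star (Dc b)) = 0 := by
    have h1 := h (star Dc)
    rw [pair27_eq_sum, pair27_eq_sum] at h1
    have h2 := mul_left_cancel₀ hη h1
    rw [← sub_eq_zero, ← Finset.sum_sub_distrib] at h2
    rw [← h2]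
    refine Finset.sum_congr rfl fun b _ => ?_
    rw [tauRecCLM_apply, tauRecCLM_apply, ← Matrix.trace_sub, ← sub_mul, hDc, Pi.star_apply, Pi.sub_apply]
  -- each summand is the Frobenius norm squared
  have htr : ∀ b, Matrix.trace (Dc b * star (Dc b)) = ((∑ i, ∑ j, Complex.normSq (Dc b i j) : ℝ) : ℂ) := fun b => by
    simp only [Matrix.trace, Matrix.diag_apply, Matrix.mul_apply, Matrix.star_apply, RCLike.star_def, Complex.mul_conj, Complex.ofReal_sum]
  have hre : ∑ b, ∑ i, ∑ j, Complex.normSq (Dc b i j) = 0 := by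
    have h0 := hsum
    simp only [htr] at h0
    exact_mod_cast h0
  have hall : ∀ b i j, Complex.normSq (Dc b i j) = 0 := by
    intro b i j
    have hb := (Finset.sum_eq_zero_iff_of_nonneg fun b _ =>
      Finset.sum_nonneg fun i _ => Finset.sum_nonneg fun j _ => Complex.normSq_nonneg (Dc b i j)).1 hre b (Finset.mem_univ b)
    have hi := (Finset.sum_eq_zero_iff_of_nonneg fun i _ => Finset.sum_nonneg fun j _ => Complex.normSq_nonneg (Dc b i j)).1 hb i (Finset.mem_univ i)
    exact (Finset.sum_eq_zero_iff_of_nonneg fun j _ => Complex.normSq_nonneg (Dc b i j)).1 hi j (Finset.mem_univ j)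
  apply (NegSup.equiv (levWeight (F.L : ℝ) ((F.P K).eta k) (bondLevLit F Ω k) 3) (Matrix (Fin N) (Fin N) ℂ)).injective
  funext b
  have hb : Dc b = 0 := Matrix.ext fun i j => by rw [Matrix.zero_apply]; exact Complex.normSq_eq_zero.1 (hall b i j)
  rw [hDc, Pi.sub_apply] at hb
  exact sub_eq_zero.1 hb

/-! ## §2  Hermitian-preserving linear maps of the space (115) commute with `σ` -/

/-- **A ℂ-LINEAR MAP PRESERVING HERMITIAN JETS COMMUTES WITH THE CONJUGATION** (`Y = Y₁ + iY₂` with `Y₁ = ½(Y + Yᴴ)`, `Y₂ = (2i)⁻¹(Y − Yᴴ)` Hermitian).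
[cite: Balaban1985Variational, (19) p.281, (51) p.286 (the real form of `𝔤ᶜ`)] -/
theorem conjJet_map_of_hermPreserving (M : Space115Lit F N K k Ω U₀ →L[ℂ] Space115Lit F N K k Ω U₀)
    (hM : ∀ Y : Space115Lit F N K k Ω U₀,
      ((JetSup.equiv _ _ (nabla115 ((F.P K).eta k) (unitsOfRecord F N U₀))).symm
          (star (JetSup.equiv _ _ (nabla115 ((F.P K).eta k) (unitsOfRecord F N U₀)) Y)) : Space115Lit F N K k Ω U₀) = Y →
      ((JetSup.equiv _ _ (nabla115 ((F.P K).eta k) (unitsOfRecord F N U₀))).symm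
          (star (JetSup.equiv _ _ (nabla115 ((F.P K).eta k) (unitsOfRecord F N U₀)) (M Y))) : Space115Lit F N K k Ω U₀) = M Y)
    (Y : Space115Lit F N K k Ω U₀) :
    ((JetSup.equiv _ _ (nabla115 ((F.P K).eta k) (unitsOfRecord F N U₀))).symm
        (star (JetSup.equiv _ _ (nabla115 ((F.P K).eta k) (unitsOfRecord F N U₀)) (M Y))) : Space115Lit F N K k Ω U₀) =
      M ((JetSup.equiv _ _ (nabla115 ((F.P K).eta k) (unitsOfRecord F N U₀))).symm
        (star (JetSup.equiv _ _ (nabla115 ((F.P K).eta k) (unitsOfRecord F N U₀)) Y))) := by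
  set τ : Space115Lit F N K k Ω U₀ → Space115Lit F N K k Ω U₀ := fun B =>
    (JetSup.equiv _ _ (nabla115 ((F.P K).eta k) (unitsOfRecord F N U₀))).symm (star (JetSup.equiv _ _ (nabla115 ((F.P K).eta k) (unitsOfRecord F N U₀)) B)) with hτ
  have hτ_add : ∀ B B', τ (B + B') = τ B + τ B' := conjJet_add F N K k Ω U₀
  have hτ_sub : ∀ B B', τ (B - B') = τ B - τ B' := conjJet_sub F N K k Ω U₀
  have hτ_smul : ∀ (c : ℂ) B, τ (c • B) = conj c • τ B := conjJet_smul F N K k Ω U₀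
  have hττ : τ (τ Y) = Y := conjJet_conjJet F N K k Ω U₀ Y
  have hM' : ∀ B, τ B = B → τ (M B) = M B := hM
  set Y₁ : Space115Lit F N K k Ω U₀ := (2 : ℂ)⁻¹ • (Y + τ Y) with hY₁
  set Y₂ : Space115Lit F N K k Ω U₀ := (2 * Complex.I)⁻¹ • (Y - τ Y) with hY₂
  have h2 : conj ((2 : ℂ)⁻¹) = (2 : ℂ)⁻¹ := by rw [map_inv₀, map_ofNat]
  have h2I : conj ((2 * Complex.I)⁻¹) = -(2 * Complex.I)⁻¹ := by rw [map_inv₀, map_mul, map_ofNat, Complex.conj_I, mul_neg, inv_neg]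
  have hI : Complex.I * (2 * Complex.I)⁻¹ = (2 : ℂ)⁻¹ := by
    rw [mul_inv, mul_comm (2 : ℂ)⁻¹, ← mul_assoc, mul_inv_cancel₀ Complex.I_ne_zero, one_mul]
  have hY₁r : τ Y₁ = Y₁ := by rw [hY₁, hτ_smul, h2, hτ_add, hττ, add_comm]
  have hY₂r : τ Y₂ = Y₂ := by rw [hY₂, hτ_smul, h2I, hτ_sub, hττ, neg_smul, ← smul_neg, neg_sub]
  have hdecomp : Y = Y₁ + Complex.I • Y₂ := by rw [hY₁, hY₂, smul_smul, hI]; module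
  have hdecomp' : τ Y = Y₁ - Complex.I • Y₂ := by rw [hY₁, hY₂, smul_smul, hI]; module
  clear_value Y₁ Y₂
  show τ (M Y) = M (τ Y)
  rw [hdecomp', map_sub, map_smul, hdecomp, map_add, map_smul, hτ_add, hτ_smul, Complex.conj_I, hM' _ hY₁r, hM' _ hY₂r, neg_smul, sub_eq_add_neg]

/-! ## §3  Transposed currents `Mᵗ K` -/

section Trans

variable [Fact (0 < c0Rec F K k)]

omit [Fact (0 < c0Rec F K k)] in
/-- ★★ **`σ(Mᵗ K) = Mᵗ (σK)` FOR A REAL OPERATOR `M`** on the space (115) (lit `transCur ρ τ M`, `ρ := rhoRec`, `τ := tr`): test against every `δ` with ✓`pair27_transCur`,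
move `σ` across the pairing (§1) and through `M`. [cite: Balaban1985Variational, (85) p.291, (88)–(90) p.291, (27) p.282] -/
theorem conjNeg3_transCur (M : Space115Lit F N K k Ω U₀ →L[ℂ] Space115Lit F N K k Ω U₀)
    (hM : ∀ Y : Space115Lit F N K k Ω U₀,
      ((JetSup.equiv _ _ (nabla115 ((F.P K).eta k) (unitsOfRecord F N U₀))).symm
          (star (JetSup.equiv _ _ (nabla115 ((F.P K).eta k) (unitsOfRecord F N U₀)) (M Y))) : Space115Lit F N K k Ω U₀) =
        M ((JetSup.equiv _ _ (nabla115 ((F.P K).eta k) (unitsOfRecord F N U₀))).symm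
          (star (JetSup.equiv _ _ (nabla115 ((F.P K).eta k) (unitsOfRecord F N U₀)) Y))))
    (Kc : NegSizeLit F N K k Ω 3) :
    ((NegSup.equiv _ _).symm (star (NegSup.equiv (levWeight (F.L : ℝ) ((F.P K).eta k) (bondLevLit F Ω k) 3) (Matrix (Fin N) (Fin N) ℂ)
        (transCur (rhoRec N) (tauRecCLM N) M Kc))) : NegSizeLit F N K k Ω 3) =
      transCur (rhoRec N) (tauRecCLM N) M
        ((NegSup.equiv _ _).symm (star (NegSup.equiv (levWeight (F.L : ℝ) ((F.P K).eta k) (bondLevLit F Ω k) 3) (Matrix (Fin N) (Fin N) ℂ) Kc))) := by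
  refine eq_of_forall_pair27_eq F N K k Ω fun δ => ?_
  have hρ := tauRecCLM_rhoRec_mul N
  rw [pair27_transCur _ _ hρ, pair27_conj_left, pair27_conj_left, ← flat115_conj, hM, pair27_transCur _ _ hρ, Equiv.apply_symm_apply]

omit [Fact (0 < c0Rec F K k)] in
/-- **`Mᵗ K` IS HERMITIAN for real `M` and Hermitian `K`.** [cite: Balaban1985Variational, (85) p.291, (88)–(89) p.291] -/
theorem transCur_herm (M : Space115Lit F N K k Ω U₀ →L[ℂ] Space115Lit F N K k Ω U₀)
    (hM : ∀ Y : Space115Lit F N K k Ω U₀,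
      ((JetSup.equiv _ _ (nabla115 ((F.P K).eta k) (unitsOfRecord F N U₀))).symm
          (star (JetSup.equiv _ _ (nabla115 ((F.P K).eta k) (unitsOfRecord F N U₀)) (M Y))) : Space115Lit F N K k Ω U₀) =
        M ((JetSup.equiv _ _ (nabla115 ((F.P K).eta k) (unitsOfRecord F N U₀))).symm
          (star (JetSup.equiv _ _ (nabla115 ((F.P K).eta k) (unitsOfRecord F N U₀)) Y))))
    {Kc : NegSizeLit F N K k Ω 3}
    (hK : ((NegSup.equiv _ _).symm (star (NegSup.equiv (levWeight (F.L : ℝ) ((F.P K).eta k) (bondLevLit F Ω k) 3) (Matrix (Fin N) (Fin N) ℂ) Kc)) :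
      NegSizeLit F N K k Ω 3) = Kc) :
    ((NegSup.equiv _ _).symm (star (NegSup.equiv (levWeight (F.L : ℝ) ((F.P K).eta k) (bondLevLit F Ω k) 3) (Matrix (Fin N) (Fin N) ℂ)
        (transCur (rhoRec N) (tauRecCLM N) M Kc))) : NegSizeLit F N K k Ω 3) = transCur (rhoRec N) (tauRecCLM N) M Kc := by
  rw [conjNeg3_transCur F N K k Ω U₀ M hM, hK]

/-! ## §4  Print's `Δ_π` letter at the record is real for real `G′` -/

variable {F' : Type*} [AddCommGroup F'] [Module ℂ F']
  {Gp : SiteL2K ℂ (F.P K).d (fun _ => (F.P K).sitesPerDir 0) (c0Rec F K k) (WRec N) →ₗ[ℂ]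
    SiteL2K ℂ (F.P K).d (fun _ => (F.P K).sitesPerDir 0) (c0Rec F K k) (WRec N)}

omit [Fact (0 < (F.L : ℝ))] [Fact (0 < (F.P K).eta k)] in
/-- **`πᵗ Δ(U₀) π` IS REAL for a real `G′`** (`πᵗ = (⋆π⋆)† = π†` for real `π`; `Δ(U₀)` real ✓p821508). [cite: Balaban1985BackgroundPropagators, (3.119) p.419, p.392] -/
theorem hessOpOfRecordPiT_starW (hGp : ∀ s, Gp (starW (phiRec N) s) = starW (phiRec N) (Gp s))
    (x : BondL2K ℂ (F.P K).d (fun _ => (F.P K).sitesPerDir 0) (c0Rec F K k) (WRec N)) :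
    hessOpOfRecordPiT F N k U₀ Gp (QflatOfRecord F N k) (starW (phiRec N) x) = starW (phiRec N) (hessOpOfRecordPiT F N k U₀ Gp (QflatOfRecord F N k) x) := by
  have hπ := piOfRecord_starW F N k U₀ hGp
  have hreal : realConj (phiRec N) (piOfRecord F N k U₀ Gp (QflatOfRecord F N k)) = piOfRecord F N k U₀ Gp (QflatOfRecord F N k) :=
    (realConj_eq_self_iff (phiRec N) _).2 hπ
  unfold hessOpOfRecordPiT deltaPi btrans
  rw [hreal]
  exact real_comp (phiRec N) (real_adjoint (phiRec N) (tauRec N) inner_phiRec_symm (tauRec_star N) (tauRec_mul_comm N) hπ)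
    (real_comp (phiRec N) (hessOpOfRecord_starW F N k U₀) hπ) x

/-- ★★ **def-Y's `Δπ = DeltaPiCurOfRecord G′ Q′♭` MAPS THE CONJUGATE JET TO THE CONJUGATE CURRENT** for real `G′`.
[cite: Balaban1985Variational, (80) p.290, (88)–(89) p.291; Balaban1985BackgroundPropagators, (3.119) p.419] -/
theorem conjNeg3_DeltaPiCurOfRecord (hGp : ∀ s, Gp (starW (phiRec N) s) = starW (phiRec N) (Gp s)) (Y : Space115Lit F N K k Ω U₀) :
    ((NegSup.equiv _ _).symm (star (NegSup.equiv (levWeight (F.L : ℝ) ((F.P K).eta k) (bondLevLit F Ω k) 3) (Matrix (Fin N) (Fin N) ℂ)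
        (DeltaPiCurOfRecord F N K k Ω U₀ Gp (QflatOfRecord F N k) Y))) : NegSizeLit F N K k Ω 3) =
      DeltaPiCurOfRecord F N K k Ω U₀ Gp (QflatOfRecord F N k)
        ((JetSup.equiv _ _ (nabla115 ((F.P K).eta k) (unitsOfRecord F N U₀))).symm
          (star (JetSup.equiv _ _ (nabla115 ((F.P K).eta k) (unitsOfRecord F N U₀)) Y))) := by
  apply (NegSup.equiv (levWeight (F.L : ℝ) ((F.P K).eta k) (bondLevLit F Ω k) 3) (Matrix (Fin N) (Fin N) ℂ)).injective
  rw [Equiv.apply_symm_apply]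
  funext b
  unfold DeltaPiCurOfRecord
  rw [Pi.star_apply, equiv_currentCLM, equiv_currentCLM, flat115_conj, funEquiv_symm_star, hessOpOfRecordPiT_starW F N K k U₀ hGp, apply_equiv_starW]

/-- **`Δπ Y` IS HERMITIAN for Hermitian `Y`** (real `G′`). [cite: Balaban1985Variational, (88)–(89) p.291] -/
theorem DeltaPiCurOfRecord_herm (hGp : ∀ s, Gp (starW (phiRec N) s) = starW (phiRec N) (Gp s)) {Y : Space115Lit F N K k Ω U₀}
    (hY : ((JetSup.equiv _ _ (nabla115 ((F.P K).eta k) (unitsOfRecord F N U₀))).symm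
      (star (JetSup.equiv _ _ (nabla115 ((F.P K).eta k) (unitsOfRecord F N U₀)) Y)) : Space115Lit F N K k Ω U₀) = Y) :
    ((NegSup.equiv _ _).symm (star (NegSup.equiv (levWeight (F.L : ℝ) ((F.P K).eta k) (bondLevLit F Ω k) 3) (Matrix (Fin N) (Fin N) ℂ)
        (DeltaPiCurOfRecord F N K k Ω U₀ Gp (QflatOfRecord F N k) Y))) : NegSizeLit F N K k Ω 3) =
      DeltaPiCurOfRecord F N K k Ω U₀ Gp (QflatOfRecord F N k) Y := by
  rw [conjNeg3_DeltaPiCurOfRecord F N K k Ω U₀ hGp, hY]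

end Trans

/-! ## §5  `W₂(A′)`, `W₃(A′)` at def-Y's letters are Hermitian on the real slice -/

section W

variable [NeZero N] [Fact (0 < c0Rec F K k)] [Fact (∀ c, 0 < wBRec F K k c)] {a : ℝ}
  (hposb : ∀ x, x ≠ 0 → 0 < RCLike.re ⟪x, laplaceAOfRecord F N k U₀ (QOfRecord F N k U₀) (QflatOfRecord F N k) a x⟫_ℂ)
  (hQ : Function.Surjective (QOfRecord F N k U₀)) (levB : PBond (F.P K) k → ℕ) {b C₂ c₄ aC εC : ℝ}
  {Gp : SiteL2K ℂ (F.P K).d (fun _ => (F.P K).sitesPerDir 0) (c0Rec F K k) (WRec N) →ₗ[ℂ]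
    SiteL2K ℂ (F.P K).d (fun _ => (F.P K).sitesPerDir 0) (c0Rec F K k) (WRec N)}
  (RC : Regime (H1OfRecordAtBgFlat F N K k Ω U₀ levB a hposb hQ) 0 (CslOfRecord F N K k Ω U₀ levB) b 0 C₂ c₄ 0 aC εC)
  (hCreal : ∀ A : Space115Lit F N K k Ω U₀,
    ((JetSup.equiv _ _ (nabla115 ((F.P K).eta k) (unitsOfRecord F N U₀))).symm
        (star (JetSup.equiv _ _ (nabla115 ((F.P K).eta k) (unitsOfRecord F N U₀)) A)) : Space115Lit F N K k Ω U₀) = A →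
    ‖A‖ ≤ εC + aC → ((NegSup.equiv _ _).symm (star (NegSup.equiv _ _ (CslOfRecord F N K k Ω U₀ levB A))) :
      NegSize (F.L : ℝ) ((F.P K).eta k) levB 0 (Matrix (Fin N) (Fin N) ℂ)) = CslOfRecord F N K k Ω U₀ levB A)

include RC hCreal in
/-- ★★ **(88): `W₂(A′) = −(Δ_π HD(A′) + 𝔇*(A′)H*Δ_π A′)` IS HERMITIAN** at def-Y's letters for Hermitian `A′`, `‖A′‖ < a_C`, real `G′` (guard; regime ∕ `Prop4Hyp` ∕ `hCreal` displayed).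
[cite: Balaban1985Variational, (87)–(88) p.291] -/
theorem W2OfRecord_herm (h : SmallBelow (avOfRecord F N K) k U₀) (hP : Prop4Hyp (CslOfRecord F N K k Ω U₀ levB) C₂ c₄)
    (hGp : ∀ s, Gp (starW (phiRec N) s) = starW (phiRec N) (Gp s)) {A' : Space115Lit F N K k Ω U₀}
    (hA' : ((JetSup.equiv _ _ (nabla115 ((F.P K).eta k) (unitsOfRecord F N U₀))).symm
      (star (JetSup.equiv _ _ (nabla115 ((F.P K).eta k) (unitsOfRecord F N U₀)) A')) : Space115Lit F N K k Ω U₀) = A') (hn : ‖A'‖ < aC) :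
    ((NegSup.equiv _ _).symm (star (NegSup.equiv (levWeight (F.L : ℝ) ((F.P K).eta k) (bondLevLit F Ω k) 3) (Matrix (Fin N) (Fin N) ℂ)
        (W2 (rhoRec N) (tauRecCLM N) (H1OfRecordAtBgFlat F N K k Ω U₀ levB a hposb hQ) (CslOfRecord F N K k Ω U₀ levB) εC
          (DeltaPiCurOfRecord F N K k Ω U₀ Gp (QflatOfRecord F N k)) A'))) : NegSizeLit F N K k Ω 3) =
      W2 (rhoRec N) (tauRecCLM N) (H1OfRecordAtBgFlat F N K k Ω U₀ levB a hposb hQ) (CslOfRecord F N K k Ω U₀ levB) εC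
        (DeltaPiCurOfRecord F N K k Ω U₀ Gp (QflatOfRecord F N k)) A' := by
  have hE := conjJet_EmapOfRecord_eq F N K k Ω U₀ levB hposb hQ RC hCreal h hA' hn
  have hM := conjJet_map_of_hermPreserving F N K k Ω U₀ _ fun Y hY => conjJet_fderiv_EmapOfRecord_eq F N K k Ω U₀ levB hposb hQ RC hCreal h hP hA' hn hY
  have h1 := DeltaPiCurOfRecord_herm F N K k Ω U₀ hGp hE
  have h2 := transCur_herm F N K k Ω U₀ _ hM (DeltaPiCurOfRecord_herm F N K k Ω U₀ hGp hA')
  apply (NegSup.equiv (levWeight (F.L : ℝ) ((F.P K).eta k) (bondLevLit F Ω k) 3) (Matrix (Fin N) (Fin N) ℂ)).injective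
  have h1' := congrArg (NegSup.equiv (levWeight (F.L : ℝ) ((F.P K).eta k) (bondLevLit F Ω k) 3) (Matrix (Fin N) (Fin N) ℂ)) h1
  have h2' := congrArg (NegSup.equiv (levWeight (F.L : ℝ) ((F.P K).eta k) (bondLevLit F Ω k) 3) (Matrix (Fin N) (Fin N) ℂ)) h2
  rw [Equiv.apply_symm_apply] at h1' h2' ⊢
  rw [W2, NegSup.equiv_neg, NegSup.equiv_add, star_neg, star_add, h1', h2']

include RC hCreal in
/-- ★★ **(89): `W₃(A′) = 𝔇*(A′)H*Δ_π HD(A′)` IS HERMITIAN** at def-Y's letters for Hermitian `A′`, `‖A′‖ < a_C`, real `G′` (guard; regime ∕ `Prop4Hyp` ∕ `hCreal` displayed).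
[cite: Balaban1985Variational, (89) p.291] -/
theorem W3OfRecord_herm (h : SmallBelow (avOfRecord F N K) k U₀) (hP : Prop4Hyp (CslOfRecord F N K k Ω U₀ levB) C₂ c₄)
    (hGp : ∀ s, Gp (starW (phiRec N) s) = starW (phiRec N) (Gp s)) {A' : Space115Lit F N K k Ω U₀}
    (hA' : ((JetSup.equiv _ _ (nabla115 ((F.P K).eta k) (unitsOfRecord F N U₀))).symm
      (star (JetSup.equiv _ _ (nabla115 ((F.P K).eta k) (unitsOfRecord F N U₀)) A')) : Space115Lit F N K k Ω U₀) = A') (hn : ‖A'‖ < aC) :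
    ((NegSup.equiv _ _).symm (star (NegSup.equiv (levWeight (F.L : ℝ) ((F.P K).eta k) (bondLevLit F Ω k) 3) (Matrix (Fin N) (Fin N) ℂ)
        (W3 (rhoRec N) (tauRecCLM N) (H1OfRecordAtBgFlat F N K k Ω U₀ levB a hposb hQ) (CslOfRecord F N K k Ω U₀ levB) εC
          (DeltaPiCurOfRecord F N K k Ω U₀ Gp (QflatOfRecord F N k)) A'))) : NegSizeLit F N K k Ω 3) =
      W3 (rhoRec N) (tauRecCLM N) (H1OfRecordAtBgFlat F N K k Ω U₀ levB a hposb hQ) (CslOfRecord F N K k Ω U₀ levB) εC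
        (DeltaPiCurOfRecord F N K k Ω U₀ Gp (QflatOfRecord F N k)) A' := by
  have hE := conjJet_EmapOfRecord_eq F N K k Ω U₀ levB hposb hQ RC hCreal h hA' hn
  have hM := conjJet_map_of_hermPreserving F N K k Ω U₀ _ fun Y hY => conjJet_fderiv_EmapOfRecord_eq F N K k Ω U₀ levB hposb hQ RC hCreal h hP hA' hn hY
  rw [W3]
  exact transCur_herm F N K k Ω U₀ _ hM (DeltaPiCurOfRecord_herm F N K k Ω U₀ hGp hE)

end W

end Summit.QuantumFields.YangMills.Theorems.N07W23OfRecordRealSlice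

end
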